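import Summits.QuantumFields.YangMills.Theorems.LuscherReductionDressedRitzPolyakovLiftEuclideanCurrencySlab
import HarnessLib

/-!
# Route `LuscherReduction`, item `DressedRitz` (stmt-QuantumFields-20205), line «polyakovlift» r5 — S-UNIV′ as a statement about FINITE free-boundary
# SLABS: `SlabChannelUniversalityAt k ⟹ EuclideanChannelUniversalityAt k (⟹ ChannelUniversalityAt k)`

Support module (LEAD prover ym-lead-20205-polyakovlift g0; `--supports stmt-QuantumFields-20205`, helper; this is lane W1-B's deliverable of `WAVE-1-BRIEFS.md`,
done by the lead while the lane was unseated).  With the slab ratios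

  `slabCorr β φ G t i l M = ⟨(G_i − c_i)Φ_M, K_β^[t]((G_l − c_l)Φ_M)⟩ / ⟨Φ_M, K_β^[t]Φ_M⟩`,  `Φ_M = slabGround β M = K_β^M 1`, `c_i = ⟨φ, G_iφ⟩`

— ratios of two free-boundary slab path integrals on `L³ × (2M + t)` (two constant-subtracted insertions `t` steps apart ∕ none) — which converge to the
normalised connected correlators `corr β φ G t i l` as `M → ∞` (`tendsto_slabCorr` = `tendsto_corr`, the vacuum dictionary at a raw vacuum):

* `SlabChannelUniversalityAt k` — the (E5)/(E6′) comparisons of `EuclideanChannelUniversalityAt k` with every `corr` (fine AND one-site shadow) replaced by the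
  slab ratio at a common finite slab parameter `M`, asserted for all `M ≥ M₀` (`M₀` may depend on everything) — degree audit: every clause is dimensionless and
  homogeneous of degree 0 in each insertion separately (condition (g));
* ★ `euclideanChannelUniversality_of_slab : SlabChannelUniversalityAt k → EuclideanChannelUniversalityAt k` (limits of products, quotients, square roots and
  absolute values of convergent sequences; the denominators' limits `corr_{2L,ii}` are positive by the tree's (o0) for every lift basis —
  `liftBasis_dressed_o0` (fine), `shadowFamily_o0` (one-site), read through `corr_dressed_norm`);
* ★ `channelUniversality_of_slab : SlabChannelUniversalityAt k → ChannelUniversalityAt k`.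

So the registered stub S-UNIV′ follows from a statement about finite Euclidean path integrals with free temporal boundary, uniformly in the slab length —
the form in which a Bałaban-type small-field/large-field analysis is carried out.

HONEST FRAMING: fixed-lattice functional analysis on the conditional femto rung R2b1; S-UNIV′ stays OPEN (this file moves it to path-integral currency, it
proves no estimate); nothing here bears on infinite volume, the continuum limit or the Clay gap.  References: E. Seiler, LNP 159 (1982) §3 [cite: SeilerLNP1982, §3];
M. Lüscher, U. Wolff, NPB 339 (1990) 222 [cite: LuscherWolff1990].
-/

set_option autoImplicit false

noncomputable section

open MeasureTheory Filter Topology Real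
open Literature.MathematicalPhysics.QuantumFieldTheory (GaugeConfig Site gaugeTransform)
open scoped BigOperators

namespace Summit.QuantumFields.YangMills.Theorems.FemtoTransferGap.PolyakovLift

open Summit.QuantumFields.YangMills.Theorems.FemtoTransferGap

/-! ## §1 Slab ratios and their limit -/

/-- **Slab ratio** at slab parameter `M`: `⟨(G_i − c_i)Φ_M, K_β^[t]((G_l − c_l)Φ_M)⟩ / ⟨Φ_M, K_β^[t]Φ_M⟩`, `Φ_M = slabGround β M`, `c_i = ⟨φ, G_iφ⟩` — a ratio of two
free-boundary slab path integrals. [cite: SeilerLNP1982, §3] -/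
def slabCorr {N : ℕ} [NeZero N] {k : ℕ} (β : ℝ) (φ : GaugeConfig 3 N SU2 → ℝ) (G : Fin k → (GaugeConfig 3 N SU2 → ℝ)) (t : ℕ) (i l : Fin k)
    (M : ℕ) : ℝ :=
  l2 ((G i - fun _ => l2 φ (G i * φ)) * slabGround (L := N) β M)
      ((transferApply β)^[t] ((G l - fun _ => l2 φ (G l * φ)) * slabGround β M)) /
    l2 (slabGround (L := N) β M) ((transferApply β)^[t] (slabGround β M))

/-- `slabCorr β φ G t i l M → corr β φ G t i l` as `M → ∞` (raw vacuum `φ`, physical insertions, `β ≥ 0`). [cite: SeilerLNP1982, §3] -/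
theorem tendsto_slabCorr {N : ℕ} [NeZero N] {k : ℕ} {β : ℝ} (hβ : 0 ≤ β) {φ : GaugeConfig 3 N SU2 → ℝ} (hφ : IsRawVacuum β φ)
    {G : Fin k → (GaugeConfig 3 N SU2 → ℝ)} (hG : ∀ i, IsPhys (G i)) (t : ℕ) (i l : Fin k) :
    Tendsto (slabCorr β φ G t i l) atTop (𝓝 (corr β φ G t i l)) :=
  tendsto_corr hβ hφ hG t i l

/-! ## §2 The finite-slab form of S-UNIV′ -/

/-- **`SlabChannelUniversalityAt k`** — (E5)/(E6′) of `EuclideanChannelUniversalityAt k` with every normalised connected correlator replaced by the finite slab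
ratio `slabCorr … M` (fine side at `β` on the `L`-lattice, one-site side at `B = oneSiteCoupling β L`, insertions `flowLiftAt 0 (flowTime β L) g_i` resp.
`g_i ∘ powLink L`, separations `2m, 2m+1`, `m = dressSteps L`), asserted for all slab parameters `M ≥ M₀`. [cite: LuscherWolff1990] -/
def SlabChannelUniversalityAt (k : ℕ) : Prop :=
  ∃ C lam0 : ℝ, 0 ≤ C ∧ 0 < lam0 ∧ ∀ lam : ℝ, 0 < lam → lam ≤ lam0 → ∃ L0 : ℕ,
    ∀ (L : ℕ) [NeZero L], L0 ≤ L → ∀ β : ℝ, InFemtoWindow lam β L →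
      ∀ φ : GaugeConfig 3 L SU2 → ℝ, IsRawVacuum β φ →
        ∀ (ω : GaugeConfig 3 1 SU2 → ℝ) (g : Fin k → (GaugeConfig 3 1 SU2 → ℝ)), LiftBasis (liftCoupling β L) k ω g →
          ∀ e₀ : GaugeConfig 3 1 SU2 → ℝ, IsRawVacuum (L := 1) (oneSiteCoupling β L) e₀ →
            let sF := slabCorr β φ (fun i => flowLiftAt (L := L) 0 (flowTime β L) (g i))
            let sO := slabCorr (oneSiteCoupling β L) e₀ (fun i => g i ∘ powLink L)
            let m := dressSteps L
            ∃ M0 : ℕ, ∀ M : ℕ, M0 ≤ M →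
              (∀ i : Fin k,
                sF (2 * m + 1) i i M * sO (2 * m) i i M ≤
                    Real.exp (C * luscherLambda β L ^ 2 / L) * (sO (2 * m + 1) i i M * sF (2 * m) i i M) ∧
                sO (2 * m + 1) i i M * sF (2 * m) i i M ≤
                    Real.exp (C * luscherLambda β L ^ 2 / L) * (sF (2 * m + 1) i i M * sO (2 * m) i i M)) ∧
              (∀ i l : Fin k, i ≠ l →
                |(sF (2 * m + 1) i l M -
                      (sF (2 * m + 1) i i M / sF (2 * m) i i M + sF (2 * m + 1) l l M / sF (2 * m) l l M) / 2 * sF (2 * m) i l M) *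
                    (Real.sqrt (sO (2 * m) i i M) * Real.sqrt (sO (2 * m) l l M)) -
                  (sO (2 * m + 1) i l M -
                      (sO (2 * m + 1) i i M / sO (2 * m) i i M + sO (2 * m + 1) l l M / sO (2 * m) l l M) / 2 * sO (2 * m) i l M) *
                    (Real.sqrt (sF (2 * m) i i M) * Real.sqrt (sF (2 * m) l l M))|
                  ≤ C * (luscherLambda β L ^ 2 / L) *
                    (Real.sqrt (sF (2 * m) i i M) * Real.sqrt (sF (2 * m) l l M)) *
                      (Real.sqrt (sO (2 * m) i i M) * Real.sqrt (sO (2 * m) l l M)))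

/-! ## §3 ★ Slab ⟹ Euclidean ⟹ channel form -/

/-- ★★ **`SlabChannelUniversalityAt k → EuclideanChannelUniversalityAt k`** (same `C`, same `lam0`; `L0` raised to `≥ 1`): pass to the limit `M → ∞` in every
clause (`tendsto_slabCorr`); the denominators' limits are positive by (o0) for every lift basis on both sides. [cite: SeilerLNP1982, §3] -/
theorem euclideanChannelUniversality_of_slab {k : ℕ} (h : SlabChannelUniversalityAt k) : EuclideanChannelUniversalityAt k := by
  obtain ⟨C, lam0, hC, hlam0, hk⟩ := h
  refine ⟨C, lam0, hC, hlam0, fun lam hlam hle => ?_⟩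
  obtain ⟨L0, hL⟩ := hk lam hlam hle
  refine ⟨max L0 1, fun L _ hL0 β hW φ hφ ω g hbasis e₀ he₀ => ?_⟩
  obtain ⟨M0, hM⟩ := hL L ((le_max_left _ _).trans hL0) β hW φ hφ ω g hbasis e₀ he₀
  have hLpos : 0 < L := lt_of_lt_of_le zero_lt_one ((le_max_right _ _).trans hL0)
  have hβ : 0 < β := zero_lt_one.trans_le hW.1
  have hΛpos : 0 < luscherLambda β L := luscherLambda_pos_of_window hlam hW
  have hLr : (0 : ℝ) < L := Nat.cast_pos.mpr hLpos
  have hBpos : 0 < oneSiteCoupling β L := by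
    unfold oneSiteCoupling; exact div_pos (mul_pos two_pos (pow_pos hLr 3)) (pow_pos hΛpos 3)
  have hB1pos : 0 < liftCoupling β L := by
    unfold liftCoupling; exact div_pos two_pos (pow_pos hΛpos 3)
  set m := dressSteps L with hm
  set G : Fin k → (GaugeConfig 3 L SU2 → ℝ) := fun i => flowLiftAt (L := L) 0 (flowTime β L) (g i) with hG
  set S : Fin k → (GaugeConfig 3 1 SU2 → ℝ) := fun i => g i ∘ powLink L with hS
  have hg : ∀ i, IsPhys (g i) := hbasis.2.2.2.2.1
  have hGi : ∀ i, IsPhys (G i) := fun i => isPhys_flowLiftAt 0 _ (hg i)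
  have hSi : ∀ i, IsPhys (S i) := fun i => isPhys_comp_powLink L (hg i)
  -- the limits
  have TF : ∀ (t : ℕ) (i l : Fin k), Tendsto (slabCorr β φ G t i l) atTop (𝓝 (corr β φ G t i l)) :=
    fun t i l => tendsto_slabCorr hβ.le hφ hGi t i l
  have TO : ∀ (t : ℕ) (i l : Fin k),
      Tendsto (slabCorr (oneSiteCoupling β L) e₀ S t i l) atTop (𝓝 (corr (oneSiteCoupling β L) e₀ S t i l)) :=
    fun t i l => tendsto_slabCorr hBpos.le he₀ hSi t i l
  -- positivity of the limiting Gram numbers ((o0) for every lift basis, both sides)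
  have hl0pos : 0 < levelValue su2Rep L β 0 := levelValue_su2Rep_pos hβ 0
  have hm0pos : 0 < levelValue su2Rep 1 (oneSiteCoupling β L) 0 := levelValue_su2Rep_pos (L := 1) hBpos 0
  have hcF0 : ∀ i : Fin k, 0 < corr β φ G (2 * m) i i := fun i => by
    have h := liftBasis_dressed_o0 hβ hφ hB1pos hbasis 0 (flowTime β L) m i
    rw [corr_dressed_norm hβ hφ.1 hGi m i i] at h
    exact pos_of_mul_pos_right h (pow_nonneg hl0pos.le _)
  have hcO0 : ∀ i : Fin k, 0 < corr (oneSiteCoupling β L) e₀ S (2 * m) i i := fun i => by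
    have h := shadowFamily_o0 hBpos hB1pos hLpos he₀ hbasis i
    simp only [shadowFamily, shadowVec] at h
    rw [corr_dressed_norm hBpos he₀.1 hSi m i i] at h
    exact pos_of_mul_pos_right h (pow_nonneg hm0pos.le _)
  have hev : ∀ᶠ M in atTop, M0 ≤ M := eventually_ge_atTop M0
  refine ⟨fun i => ⟨?_, ?_⟩, fun i l hil => ?_⟩
  · refine le_of_tendsto_of_tendsto ((TF _ i i).mul (TO _ i i)) (((TO _ i i).mul (TF _ i i)).const_mul _) ?_
    exact hev.mono fun M hMM => ((hM M hMM).1 i).1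
  · refine le_of_tendsto_of_tendsto ((TO _ i i).mul (TF _ i i)) (((TF _ i i).mul (TO _ i i)).const_mul _) ?_
    exact hev.mono fun M hMM => ((hM M hMM).1 i).2
  · have TsF : Tendsto (fun M => Real.sqrt (slabCorr β φ G (2 * m) i i M) * Real.sqrt (slabCorr β φ G (2 * m) l l M)) atTop
        (𝓝 (Real.sqrt (corr β φ G (2 * m) i i) * Real.sqrt (corr β φ G (2 * m) l l))) :=
      (TF _ i i).sqrt.mul (TF _ l l).sqrt
    have TsO : Tendsto (fun M => Real.sqrt (slabCorr (oneSiteCoupling β L) e₀ S (2 * m) i i M) *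
          Real.sqrt (slabCorr (oneSiteCoupling β L) e₀ S (2 * m) l l M)) atTop
        (𝓝 (Real.sqrt (corr (oneSiteCoupling β L) e₀ S (2 * m) i i) * Real.sqrt (corr (oneSiteCoupling β L) e₀ S (2 * m) l l))) :=
      (TO _ i i).sqrt.mul (TO _ l l).sqrt
    have TAF : Tendsto (fun M => slabCorr β φ G (2 * m + 1) i l M -
          (slabCorr β φ G (2 * m + 1) i i M / slabCorr β φ G (2 * m) i i M +
              slabCorr β φ G (2 * m + 1) l l M / slabCorr β φ G (2 * m) l l M) / 2 * slabCorr β φ G (2 * m) i l M) atTop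
        (𝓝 (corr β φ G (2 * m + 1) i l -
          (corr β φ G (2 * m + 1) i i / corr β φ G (2 * m) i i + corr β φ G (2 * m + 1) l l / corr β φ G (2 * m) l l) / 2 *
            corr β φ G (2 * m) i l)) :=
      (TF _ i l).sub ((((TF _ i i).div (TF _ i i) (hcF0 i).ne').add ((TF _ l l).div (TF _ l l) (hcF0 l).ne')).div_const 2 |>.mul
        (TF _ i l))
    have TAO : Tendsto (fun M => slabCorr (oneSiteCoupling β L) e₀ S (2 * m + 1) i l M -
          (slabCorr (oneSiteCoupling β L) e₀ S (2 * m + 1) i i M / slabCorr (oneSiteCoupling β L) e₀ S (2 * m) i i M +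
              slabCorr (oneSiteCoupling β L) e₀ S (2 * m + 1) l l M / slabCorr (oneSiteCoupling β L) e₀ S (2 * m) l l M) / 2 *
            slabCorr (oneSiteCoupling β L) e₀ S (2 * m) i l M) atTop
        (𝓝 (corr (oneSiteCoupling β L) e₀ S (2 * m + 1) i l -
          (corr (oneSiteCoupling β L) e₀ S (2 * m + 1) i i / corr (oneSiteCoupling β L) e₀ S (2 * m) i i +
              corr (oneSiteCoupling β L) e₀ S (2 * m + 1) l l / corr (oneSiteCoupling β L) e₀ S (2 * m) l l) / 2 *
            corr (oneSiteCoupling β L) e₀ S (2 * m) i l)) :=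
      (TO _ i l).sub ((((TO _ i i).div (TO _ i i) (hcO0 i).ne').add ((TO _ l l).div (TO _ l l) (hcO0 l).ne')).div_const 2 |>.mul
        (TO _ i l))
    refine le_of_tendsto_of_tendsto (((TAF.mul TsO).sub (TAO.mul TsF)).abs) ((TsF.const_mul _).mul TsO) ?_
    exact hev.mono fun M hMM => (hM M hMM).2 i l hil

/-- ★ **`SlabChannelUniversalityAt k → ChannelUniversalityAt k`** — the registered stub S-UNIV′ from the finite-slab statement. [cite: LuscherWolff1990] -/
theorem channelUniversality_of_slab {k : ℕ} (h : SlabChannelUniversalityAt k) : ChannelUniversalityAt k :=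
  channelUniversality_of_euclidean (euclideanChannelUniversality_of_slab h)

end Summit.QuantumFields.YangMills.Theorems.FemtoTransferGap.PolyakovLift

end
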